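import Summits.QuantumFields.QCD.Theses.AnomalyRigidity
import Summits.QuantumFields.QCD.Theorems.HeatSlicedQuarksRobustYangMillsHandoverStubTreeDecayBoundsGermLatticeSums
import Summits.QuantumFields.QCD.Theorems.HeatSlicedQuarksRobustYangMillsHandoverStubTreeDecayBoundsGermMoments

/-!
# Stub `stub_treeDecayBoundsGerm` of line `lee-yang-mass-handover`
(crux `Summit.QuantumFields.QCD.Theses.HeatSlicedQuarks.RobustYangMillsHandover`,
item stmt-QuantumFields-8892)

**Tree decay + local moment bounds ⇒ m-uniformly bounded mixed germ** — item stmt-QuantumFields-16261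
`Summit.QuantumFields.QCD.Theses.AnomalyRigidity.TreeDecayBoundsGerm` of route AnomalyRigidity, verbatim.

Proof (pure real analysis on top of the two landed engine files).
* `treeGerm_sum_shift_le`: a non-negative function summed over the translate `y - x`, `x, y ∈ box 4 S`,
  is dominated by its sum over `box 4 (2S)`.
* `treeGerm_far_weight_sum`: for `0 < ε'`, `σ < 4` there is `Cf` with
  `a⁸ ∑∑_{x,y ∈ box} ‖ξ‖^i ‖η‖^j e^{−ε' max(‖ξ‖,‖η‖)} (1 + (a + min(‖ξ‖,‖η‖,‖ξ−η‖))^{−σ}) ≤ Cf` uniformly in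
  `0 < a ≤ 1`, the box and `i, j ≤ 2` (`ξ = a x`): the pointwise bound `treeGerm_pointwise_far_bound`
  splits the weight into products of one-particle factors, each summed by `treeGerm_four_dim_bound`
  (the partial-diagonal factor after the shift `y ↦ y − x`).
* `treeGerm_main`: the GLOBAL weighted moments are eventually bounded by `Mb = Cl + max C 0 · Cf`,
  uniformly in `m, μ, ν` — near region (`‖ξ‖, ‖η‖ ≤ max R₀ 1`) by the local moment hypothesis, far region by
  tree decay and `treeGerm_far_weight_sum` (using `a_k ≤ 1` eventually, from `a_k → 0`); then
  `treeGerm_germ_bound_of_moments` gives the bounded germ with `K = Mb`.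
* `stub_treeDecayBoundsGerm`: the item, by instantiating `treeGerm_main` at the lattice-QCD three-point
  functions.
-/

namespace Summit.QuantumFields.QCD.Cruxes.RobustYangMillsHandover.LeeYangMassHandover

open Filter Topology Asymptotics Finset Literature.Probability.LatticeModels
open Summit.QuantumFields.QCD.Theses.AnomalyRigidity
open Literature.MathematicalPhysics.QuantumFieldTheory

/-! ## Lattice sums: the shifted box and the far-region weight -/

/-- A non-negative function summed over the differences `y - x`, `y ∈ box 4 S`, for a fixed `x ∈ box 4 S`,
is at most its sum over the doubled box. [folklore] -/
theorem treeGerm_sum_shift_le (S : ℕ) (x : Fin 4 → ℤ) (hx : x ∈ box 4 S) (f : (Fin 4 → ℤ) → ℝ)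
    (hf : ∀ z, 0 ≤ f z) :
    ∑ y ∈ box 4 S, f (y - x) ≤ ∑ z ∈ box 4 (2 * S), f z := by
  classical
  have hinj : Set.InjOn (fun y : Fin 4 → ℤ => y - x) ↑(box 4 S) := fun y _ y' _ h => by
    simpa using h
  rw [← Finset.sum_image hinj]
  refine Finset.sum_le_sum_of_subset_of_nonneg ?_ fun z _ _ => hf z
  intro z hz
  rw [Finset.mem_image] at hz
  obtain ⟨y, hy, rfl⟩ := hz
  rw [mem_box] at hx hy ⊢
  intro i
  have h1 := hx i
  have h2 := hy i
  simp only [Pi.sub_apply]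
  push_cast
  omega

/-- **The far-region weight is uniformly summable at lattice resolution**: for `0 < ε'`, `σ < 4` there is
`Cf ≥ 0` with `a⁸ ∑∑ ‖ξ‖^i ‖η‖^j e^{−ε' max(‖ξ‖,‖η‖)} (1 + (a + min(‖ξ‖, ‖η‖, ‖ξ − η‖))^{−σ}) ≤ Cf` for all
`0 < a ≤ 1`, all boxes and `i, j ≤ 2` (`ξ = a x`, `η = a y`, sup norm). [folklore] -/
theorem treeGerm_far_weight_sum (ε' σ : ℝ) (hε' : 0 < ε') (hσ : σ < 4) :
    ∃ Cf : ℝ, 0 ≤ Cf ∧ ∀ a : ℝ, 0 < a → a ≤ 1 → ∀ φ : (Fin 4 → ℤ) → (Fin 4 → ℝ),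
      (∀ x i, φ x i = a * (x i : ℝ)) → ∀ (S : ℕ) (i j : ℕ), i ≤ 2 → j ≤ 2 →
        ∑ x ∈ box 4 S, ∑ y ∈ box 4 S, a ^ 8 * ‖φ x‖ ^ i * ‖φ y‖ ^ j *
          (Real.exp (-(ε' * max ‖φ x‖ ‖φ y‖)) *
            (1 + (a + min ‖φ x‖ (min ‖φ y‖ ‖φ x - φ y‖)) ^ (-σ))) ≤ Cf := by
  set s : ℝ := max σ 0 with hs
  have hs0 : 0 ≤ s := le_max_right _ _
  have hs4 : s < 4 := max_lt hσ (by norm_num)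
  set c : ℝ := ε' / 8 with hc
  have hc0 : 0 < c := by positivity
  obtain ⟨Λ0, hΛ0, hΛ0b⟩ := treeGerm_four_dim_bound 0 c le_rfl (by norm_num) hc0
  obtain ⟨Λs, hΛs, hΛsb⟩ := treeGerm_four_dim_bound s c hs0 hs4 hc0
  set N : ℕ := ⌈-σ⌉₊ with hN
  have hNσ : -σ ≤ (N : ℝ) := Nat.le_ceil (-σ)
  set K : ℝ := (4 + N).factorial / (ε' / 2) ^ (4 + N) * Real.exp (ε' / 2) with hK
  have hK0 : 0 ≤ K := by positivity
  refine ⟨K * (2 * (Λ0 * Λ0) + Λs * Λ0 + Λ0 * Λs + Λ0 * Λs), by positivity, ?_⟩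
  intro a ha ha1 φ hφ S i j hi hj
  -- one-particle factors
  set A : (Fin 4 → ℤ) → ℝ := fun x => a ^ 4 * Real.exp (-(c * ‖φ x‖)) with hA
  set B : (Fin 4 → ℤ) → ℝ := fun x => a ^ 4 * ((a + ‖φ x‖) ^ (-s) * Real.exp (-(c * ‖φ x‖))) with hB
  set Bd : (Fin 4 → ℤ) → (Fin 4 → ℤ) → ℝ := fun x y =>
    a ^ 4 * ((a + ‖φ x - φ y‖) ^ (-s) * Real.exp (-(c * ‖φ x - φ y‖))) with hBd
  have hA0 : ∀ x, 0 ≤ A x := fun x => by positivity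
  have hB0 : ∀ x, 0 ≤ B x := fun x => by positivity
  have hBd0 : ∀ x y, 0 ≤ Bd x y := fun x y => by positivity
  -- their sums
  have hSA : ∀ T : ℕ, ∑ x ∈ box 4 T, A x ≤ Λ0 := by
    intro T
    have h := hΛ0b a ha ha1 φ hφ T
    simp only [neg_zero, Real.rpow_zero, one_mul] at h
    rwa [hA, ← Finset.mul_sum]
  have hSB : ∀ T : ℕ, ∑ x ∈ box 4 T, B x ≤ Λs := by
    intro T
    have h := hΛsb a ha ha1 φ hφ T
    rwa [hB, ← Finset.mul_sum]
  have hφsub : ∀ x y : Fin 4 → ℤ, ‖φ x - φ y‖ = ‖φ (y - x)‖ := by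
    intro x y
    rw [← norm_neg]
    congr 1
    funext k
    simp only [Pi.neg_apply, Pi.sub_apply, hφ, Int.cast_sub]
    ring
  have hSBd : ∀ x ∈ box 4 S, ∑ y ∈ box 4 S, Bd x y ≤ Λs := by
    intro x hx
    have h1 : ∑ y ∈ box 4 S, Bd x y = ∑ y ∈ box 4 S, B (y - x) :=
      Finset.sum_congr rfl fun y _ => by simp only [hBd, hB, hφsub]
    rw [h1]
    refine (treeGerm_sum_shift_le S x hx B hB0).trans ?_
    exact hSB (2 * S)
  -- pointwise bound
  have hpt : ∀ x y : Fin 4 → ℤ,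
      a ^ 8 * ‖φ x‖ ^ i * ‖φ y‖ ^ j * (Real.exp (-(ε' * max ‖φ x‖ ‖φ y‖)) *
        (1 + (a + min ‖φ x‖ (min ‖φ y‖ ‖φ x - φ y‖)) ^ (-σ)))
        ≤ K * (2 * (A x * A y) + B x * A y + A x * B y + A x * Bd x y) := by
    intro x y
    have h := treeGerm_pointwise_far_bound ε' σ hε' N hNσ i j hi hj a ‖φ x‖ ‖φ y‖ ‖φ x - φ y‖
      ha ha1 (norm_nonneg _) (norm_nonneg _) (norm_nonneg _) (norm_sub_le _ _)
    simpa only [hA, hB, hBd, hK, hc, hs] using h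
  -- sum it
  calc ∑ x ∈ box 4 S, ∑ y ∈ box 4 S, a ^ 8 * ‖φ x‖ ^ i * ‖φ y‖ ^ j *
          (Real.exp (-(ε' * max ‖φ x‖ ‖φ y‖)) * (1 + (a + min ‖φ x‖ (min ‖φ y‖ ‖φ x - φ y‖)) ^ (-σ)))
      ≤ ∑ x ∈ box 4 S, ∑ y ∈ box 4 S, K * (2 * (A x * A y) + B x * A y + A x * B y + A x * Bd x y) :=
        Finset.sum_le_sum fun x _ => Finset.sum_le_sum fun y _ => hpt x y
    _ = K * (2 * ((∑ x ∈ box 4 S, A x) * ∑ y ∈ box 4 S, A y) +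
          (∑ x ∈ box 4 S, B x) * (∑ y ∈ box 4 S, A y) + (∑ x ∈ box 4 S, A x) * (∑ y ∈ box 4 S, B y) +
          ∑ x ∈ box 4 S, A x * ∑ y ∈ box 4 S, Bd x y) := by
        rw [Finset.sum_mul_sum, Finset.sum_mul_sum, Finset.sum_mul_sum, Finset.mul_sum, ← Finset.sum_add_distrib,
          ← Finset.sum_add_distrib, ← Finset.sum_add_distrib, Finset.mul_sum]
        refine Finset.sum_congr rfl fun x _ => ?_
        rw [Finset.mul_sum, Finset.mul_sum, ← Finset.sum_add_distrib, ← Finset.sum_add_distrib,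
          ← Finset.sum_add_distrib, Finset.mul_sum]
    _ ≤ K * (2 * (Λ0 * Λ0) + Λs * Λ0 + Λ0 * Λs + Λ0 * Λs) := by
        refine mul_le_mul_of_nonneg_left ?_ hK0
        have sA := hSA S
        have sB := hSB S
        have sA0 : 0 ≤ ∑ x ∈ box 4 S, A x := Finset.sum_nonneg fun x _ => hA0 x
        have sB0 : 0 ≤ ∑ x ∈ box 4 S, B x := Finset.sum_nonneg fun x _ => hB0 x
        have sD : ∑ x ∈ box 4 S, A x * ∑ y ∈ box 4 S, Bd x y ≤ Λ0 * Λs := by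
          calc ∑ x ∈ box 4 S, A x * ∑ y ∈ box 4 S, Bd x y ≤ ∑ x ∈ box 4 S, A x * Λs :=
                Finset.sum_le_sum fun x hx => mul_le_mul_of_nonneg_left (hSBd x hx) (hA0 x)
            _ = (∑ x ∈ box 4 S, A x) * Λs := by rw [Finset.sum_mul]
            _ ≤ Λ0 * Λs := mul_le_mul_of_nonneg_right sA hΛs
        have e1 : (∑ x ∈ box 4 S, A x) * ∑ y ∈ box 4 S, A y ≤ Λ0 * Λ0 := mul_le_mul sA sA sA0 hΛ0
        have e2 : (∑ x ∈ box 4 S, B x) * ∑ y ∈ box 4 S, A y ≤ Λs * Λ0 := mul_le_mul sB sA sA0 hΛs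
        have e3 : (∑ x ∈ box 4 S, A x) * ∑ y ∈ box 4 S, B y ≤ Λ0 * Λs := mul_le_mul sA sB sB0 hΛ0
        linarith

/-! ## The analytic statement behind item 16261 -/

/-- **Tree decay + local moments ⇒ bounded mixed germ, m-uniformly** (the analytic content of item 16261, for
abstract lattice data `w_k G_m^{μν}(k,S;x,y)` on the scaled lattices `a_k ℤ⁴`, `a_k → 0`): near region by the
local weighted-moment hypothesis at radius `max R₀ 1`, far region by the tree-decay bound and
`treeGerm_far_weight_sum`, then `treeGerm_germ_bound_of_moments`. [folklore] -/
theorem treeGerm_main (a : ℕ → ℝ) (ha : ∀ k, 0 < a k) (hat : Tendsto a atTop (𝓝 0)) (L : ℕ → ℕ)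
    (w : ℕ → ℂ) (G : ℝ → Fin 4 → Fin 4 → ℕ → ℕ → (Fin 4 → ℤ) → (Fin 4 → ℤ) → ℂ)
    (ΓP : ℝ → (Fin 4 → ℝ) → (Fin 4 → ℝ) → Fin 4 → Fin 4 → ℂ) (m₁ : ℝ) (hm₁1 : m₁ ≤ 1)
    (hconv : ∀ m : ℝ, 0 < m → m ≤ m₁ → ∀ (p q : Fin 4 → ℝ) (μ ν : Fin 4) (δ : ℝ), 0 < δ →
      ∀ᶠ k in atTop, ∀ S : ℕ, L k ≤ S →
        ‖((a k ^ 8 : ℝ) : ℂ) * ∑ x ∈ box 4 S, ∑ y ∈ box 4 S,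
            Complex.exp (Complex.I *
              ((∑ i, (p i * (a k * (x i : ℝ)) + q i * (a k * (y i : ℝ))) : ℝ) : ℂ)) *
              w k * G m μ ν k S x y - ΓP m p q μ ν‖ ≤ δ)
    (hmom : ∀ Rl : ℝ, 0 < Rl → ∃ C : ℝ, ∀ m : ℝ, 0 < m → m ≤ 1 → ∀ i j : ℕ, 1 ≤ i → i ≤ 2 → 1 ≤ j →
      j ≤ 2 → ∀ μ ν : Fin 4, ∀ᶠ k in atTop, ∀ S : ℕ, L k ≤ S →
        (∑ x ∈ box 4 S, ∑ y ∈ box 4 S,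
          if ‖(fun i => a k * (x i : ℝ))‖ ≤ Rl ∧ ‖(fun i => a k * (y i : ℝ))‖ ≤ Rl then
            a k ^ 8 * ‖(fun i => a k * (x i : ℝ))‖ ^ i * ‖(fun i => a k * (y i : ℝ))‖ ^ j *
              ‖w k * G m μ ν k S x y‖
          else 0) ≤ C)
    (htree : ∃ C ε' σ R₀ : ℝ, 0 < ε' ∧ σ < 4 ∧ ∀ m : ℝ, 0 < m → m ≤ m₁ → ∀ μ ν : Fin 4,
      ∀ᶠ k in atTop, ∀ S : ℕ, L k ≤ S → ∀ x ∈ box 4 S, ∀ y ∈ box 4 S,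
        R₀ ≤ max ‖(fun i => a k * (x i : ℝ))‖ ‖(fun i => a k * (y i : ℝ))‖ →
          ‖w k * G m μ ν k S x y‖ ≤
            C * Real.exp (-(ε' * max ‖(fun i => a k * (x i : ℝ))‖ ‖(fun i => a k * (y i : ℝ))‖)) *
              (1 + (a k + min ‖(fun i => a k * (x i : ℝ))‖ (min ‖(fun i => a k * (y i : ℝ))‖
                ‖(fun i => a k * (x i : ℝ)) - fun i => a k * (y i : ℝ)‖)) ^ (-σ))) :
    ∃ K : ℝ, ∀ m : ℝ, 0 < m → m ≤ m₁ → ∀ μ ν : Fin 4, ∃ B : Fin 4 → Fin 4 → ℂ,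
      (∀ al be, ‖B al be‖ ≤ K) ∧
        (fun k : (Fin 4 → ℝ) × (Fin 4 → ℝ) =>
            ΓP m k.1 k.2 μ ν - ΓP m k.1 0 μ ν - ΓP m 0 k.2 μ ν + ΓP m 0 0 μ ν -
              ∑ al : Fin 4, ∑ be : Fin 4, B al be * ((k.1 al : ℝ) : ℂ) * ((k.2 be : ℝ) : ℂ)) =o[𝓝 0]
          (fun k : (Fin 4 → ℝ) × (Fin 4 → ℝ) => ‖k‖ ^ 2) := by
  obtain ⟨CT, ε', σ, R₀, hε', hσ, htree⟩ := htree
  obtain ⟨Cf, hCf0, hCf⟩ := treeGerm_far_weight_sum ε' σ hε' hσ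
  set Rl : ℝ := max R₀ 1 with hRl
  have hRl0 : 0 < Rl := lt_of_lt_of_le one_pos (le_max_right _ _)
  have hR₀ : R₀ ≤ Rl := le_max_left _ _
  obtain ⟨Cl, hCl⟩ := hmom Rl hRl0
  have ha1 : ∀ᶠ k in atTop, a k ≤ 1 := hat.eventually (eventually_le_nhds one_pos)
  refine ⟨Cl + max CT 0 * Cf, fun m hm hm1 μ ν => ?_⟩
  refine treeGerm_germ_bound_of_moments a L (fun k x i => a k * (x i : ℝ)) w
    (fun k S x y => G m μ ν k S x y) (fun p q => ΓP m p q μ ν) (Cl + max CT 0 * Cf) ?_ ?_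
  · intro p q δ hδ
    exact hconv m hm hm1 p q μ ν δ hδ
  · intro i j hi1 hi2 hj1 hj2
    filter_upwards [hCl m hm (hm1.trans hm₁1) i j hi1 hi2 hj1 hj2 μ ν, htree m hm hm1 μ ν, ha1]
      with k hloc htr hak S hS
    have hloc := hloc S hS
    have htr := htr S hS
    have hak0 : 0 < a k := ha k
    -- the scaled lattice at step `k`
    set φ : (Fin 4 → ℤ) → (Fin 4 → ℝ) := fun x i => a k * (x i : ℝ) with hφ
    have hφx : ∀ x : Fin 4 → ℤ, (fun i => a k * (x i : ℝ)) = φ x := fun x => rfl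
    simp only [hφx] at hloc htr ⊢
    -- the summand and its near/far split
    set f : (Fin 4 → ℤ) → (Fin 4 → ℤ) → ℝ := fun x y =>
      a k ^ 8 * ‖φ x‖ ^ i * ‖φ y‖ ^ j * ‖w k * G m μ ν k S x y‖ with hf
    have hf0 : ∀ x y, 0 ≤ f x y := fun x y => by positivity
    set Ew : (Fin 4 → ℤ) → (Fin 4 → ℤ) → ℝ := fun x y =>
      a k ^ 8 * ‖φ x‖ ^ i * ‖φ y‖ ^ j * (Real.exp (-(ε' * max ‖φ x‖ ‖φ y‖)) *
        (1 + (a k + min ‖φ x‖ (min ‖φ y‖ ‖φ x - φ y‖)) ^ (-σ))) with hEw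
    have hEw0 : ∀ x y, 0 ≤ Ew x y := fun x y => by positivity
    have hfar : ∀ x ∈ box 4 S, ∀ y ∈ box 4 S, ¬ (‖φ x‖ ≤ Rl ∧ ‖φ y‖ ≤ Rl) →
        f x y ≤ max CT 0 * Ew x y := by
      intro x hx y hy hnot
      have hmax : R₀ ≤ max ‖φ x‖ ‖φ y‖ := by
        rcases not_and_or.mp hnot with h | h
        · exact hR₀.trans ((not_le.mp h).le.trans (le_max_left _ _))
        · exact hR₀.trans ((not_le.mp h).le.trans (le_max_right _ _))
      have hb := htr x hx y hy hmax
      have hE0 : 0 ≤ Real.exp (-(ε' * max ‖φ x‖ ‖φ y‖)) *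
          (1 + (a k + min ‖φ x‖ (min ‖φ y‖ ‖φ x - φ y‖)) ^ (-σ)) := by positivity
      have hb' : ‖w k * G m μ ν k S x y‖ ≤ max CT 0 * (Real.exp (-(ε' * max ‖φ x‖ ‖φ y‖)) *
          (1 + (a k + min ‖φ x‖ (min ‖φ y‖ ‖φ x - φ y‖)) ^ (-σ))) := by
        calc ‖w k * G m μ ν k S x y‖
            ≤ CT * Real.exp (-(ε' * max ‖φ x‖ ‖φ y‖)) *
                (1 + (a k + min ‖φ x‖ (min ‖φ y‖ ‖φ x - φ y‖)) ^ (-σ)) := hb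
          _ = CT * (Real.exp (-(ε' * max ‖φ x‖ ‖φ y‖)) *
                (1 + (a k + min ‖φ x‖ (min ‖φ y‖ ‖φ x - φ y‖)) ^ (-σ))) := by ring
          _ ≤ _ := mul_le_mul_of_nonneg_right (le_max_left _ _) hE0
      calc f x y = a k ^ 8 * ‖φ x‖ ^ i * ‖φ y‖ ^ j * ‖w k * G m μ ν k S x y‖ := rfl
        _ ≤ a k ^ 8 * ‖φ x‖ ^ i * ‖φ y‖ ^ j * (max CT 0 * (Real.exp (-(ε' * max ‖φ x‖ ‖φ y‖)) *
            (1 + (a k + min ‖φ x‖ (min ‖φ y‖ ‖φ x - φ y‖)) ^ (-σ)))) :=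
          mul_le_mul_of_nonneg_left hb' (by positivity)
        _ = max CT 0 * Ew x y := by simp only [hEw]; ring
    have hsplit : ∀ x y, f x y = (if ‖φ x‖ ≤ Rl ∧ ‖φ y‖ ≤ Rl then f x y else 0) +
        (if ‖φ x‖ ≤ Rl ∧ ‖φ y‖ ≤ Rl then 0 else f x y) := by
      intro x y
      split_ifs <;> simp
    calc ∑ x ∈ box 4 S, ∑ y ∈ box 4 S, a k ^ 8 * ‖φ x‖ ^ i * ‖φ y‖ ^ j * ‖w k * G m μ ν k S x y‖
        = ∑ x ∈ box 4 S, ∑ y ∈ box 4 S, f x y := rfl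
      _ = (∑ x ∈ box 4 S, ∑ y ∈ box 4 S, if ‖φ x‖ ≤ Rl ∧ ‖φ y‖ ≤ Rl then f x y else 0) +
            ∑ x ∈ box 4 S, ∑ y ∈ box 4 S, (if ‖φ x‖ ≤ Rl ∧ ‖φ y‖ ≤ Rl then 0 else f x y) := by
          rw [← Finset.sum_add_distrib]
          refine Finset.sum_congr rfl fun x _ => ?_
          rw [← Finset.sum_add_distrib]
          exact Finset.sum_congr rfl fun y _ => hsplit x y
      _ ≤ Cl + max CT 0 * Cf := by
          refine add_le_add hloc ?_
          calc ∑ x ∈ box 4 S, ∑ y ∈ box 4 S, (if ‖φ x‖ ≤ Rl ∧ ‖φ y‖ ≤ Rl then 0 else f x y)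
              ≤ ∑ x ∈ box 4 S, ∑ y ∈ box 4 S, max CT 0 * Ew x y := by
                refine Finset.sum_le_sum fun x hx => Finset.sum_le_sum fun y hy => ?_
                split_ifs with h
                · exact mul_nonneg (le_max_right _ _) (hEw0 x y)
                · exact hfar x hx y hy h
            _ = max CT 0 * ∑ x ∈ box 4 S, ∑ y ∈ box 4 S, Ew x y := by
                rw [Finset.mul_sum]
                exact Finset.sum_congr rfl fun x _ => by rw [Finset.mul_sum]
            _ ≤ max CT 0 * Cf := by
                refine mul_le_mul_of_nonneg_left ?_ (le_max_right _ _)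
                exact hCf (a k) (ha k) hak φ (fun x i => rfl) S i j hi2 hj2

/-! ## The item -/

/-- **Item stmt-QuantumFields-16261 `AnomalyRigidity.TreeDecayBoundsGerm`**: if the torus transforms of
`u³⟨V_μ(x)V_ν(y)P(0)⟩` converge to `Γ^P_m` (`m ∈ (0, m₁]`) for all tori `S ≥ L_k` eventually in `k`, the
m-uniform local weighted-moment bounds hold and the tree-decay bound holds, then the mixed second difference of
`Γ^P_m` at zero momentum is a bilinear form `B` up to `o(‖(p,q)‖²)`, with `|B_{αβ}| ≤ K` uniformly in
`m, μ, ν`. [cite: GlimmJaffe1987, §6.1] -/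
theorem stub_treeDecayBoundsGerm : TreeDecayBoundsGerm := by
  intro Nf reg V P uV uP ΓP m₁
  dsimp only
  intro hm₁ hm₁1 hconv hmom htree
  exact treeGerm_main reg.a reg.a_pos reg.tendsto_a reg.L (fun k => ((uV k * uV k * uP k : ℝ) : ℂ))
    (fun m μ ν k S x y => qcdTorusExpect (reg.β k) (2 * S + 1)
      (fun fl => (reg.scheme (fun _ : Fin Nf => m) 0 0).mq fl k)
      (fun U => (V μ).onTorus (2 * S + 1) x U * (V ν).onTorus (2 * S + 1) y U * P.onTorus (2 * S + 1) 0 U))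
    ΓP m₁ hm₁1 hconv hmom htree

end Summit.QuantumFields.QCD.Cruxes.RobustYangMillsHandover.LeeYangMassHandover
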